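import Summits.BirchSwinnertonDyer.Rank1Residual.Additive.RamifiedSevenGenusKatoPinnedFrame
import Summits.BirchSwinnertonDyer.Rank1Residual.Additive.RamifiedSevenGenusNumberFieldColumn
import Literature.NumberTheory.EllipticCurves.Kato2004.IwasawaCohomologyNumberFieldCMOrder
import HarnessLib

set_option autoImplicit false

/-!
# `𝒞₇` genus road (crux `EllipticUnitValueSevenOfGZK`, K7r), row K2C-6 = CARRIER-1, block (C1): the CARRIER ALGEBRA
# of the pinned Kato frame — the fourteen algebra fields of `KatoGenusFrame` / `PinnedKatoGenusFrame` SERVED, one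
# named theorem per field, over the CONCRETE carriers `R = Λ[ϖ]/(ϖ² + 7)`, `A = 𝐇¹_{K,Γ}(T₇W_K)[1/7]`,
# `ιS = (x ↦ x/1)`, `j = ιS ∘ res`, `π = ϖ ↦ (√−7)_*` — THEOREMS over (A)/(L)/(D); no structure, no def, no fact

Cell `bsd-cm`, seat `bsd-cm-prr-ty1` g34 (literature-prover), SUMMON `wake/SUMMON-bsd-cm-prr-ty1-20260830T2355Z.md`
(c73b963b3a51998d; planner D1000 (C)), scoping memo `bsd-cm-prr-ty1/g33/CarrierColumn-scope.md` (c1ed60c7a00cd5c2) §1 row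
(C1), CHECK (CAR-1) on the cell STATUS (2026-08-31).  Crux `stmt-BirchSwinnertonDyer-19945` (route K7r
`RamifiedSevenEllipticUnits`), skeleton zp v16 `Cruxes/EllipticUnitValueSevenOfGZK/Lines/kato_perrin_riou_zp.lean`
(bb91f352028468bc), K2ᶜ input stub `stub_integralComparisonInputsSeven` — whose undischarged part is the INHABITATION of
`Φ : GenusSeven.PinnedKatoGenusFrame W K hK I d` (`RamifiedSevenGenusKatoPinnedFrame.lean` l.159–213, extending
`GenusSeven.KatoGenusFrame`, `RamifiedSevenGenusKatoShapes.lean` l.147–204).  HONEST LABEL: this file proves the algebra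
fields are inhabitable by the genuine objects and NOTHING ELSE: it constructs no `PinnedKatoGenusFrame` (the ★-column
(C2), the elliptic-unit column (C3), the frame lemma `EU_not_mem_of_residue` (C5), the kernel (C4) and the
`DualExpValueDatum` (C6) are not here), closes no stub; stmt-BirchSwinnertonDyer-19945 is OPEN (4 sorries); K2ᶜ
inhabitation is NOT done; `X12.CMRamifiedSeven` is NOT proved; no summit statement is proved by this seat; BSD is claimed
for no curve.

## The design rule of the row (pen D1000) and the field table (CHECK (CAR-1))

NO new `structure`/`def`/`abbrev`/instance: the carriers are EXISTING TERMS of the Literature files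
(A) `Kato2004/IwasawaCohomologyNumberFieldCMOrder.lean` (p777087), (L) `Kato2004/IwasawaCohomologyNumberFieldIsogeny.lean`
(p776319), (D) `Kato2004/IwasawaH1NumberFieldTorsionFreeProofs.lean` (p776780), and every PROP-valued frame field is ONE
NAMED THEOREM below whose type is the field's type with those terms substituted, so that the eventual constructor of
`Φ` closes the field by `exact`.  First binders: `h2 : finrank ℚ Kcm = 2`; the `K`-side pinned Iwasawa cohomology
`IK : IwasawaH1DataOver (W.baseChange Kcm) 7 (K.restrictOfFinrankEqTwo (by decide) Kcm h2) γK` with `hγK` (inhabited: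
`nonempty_iwasawaH1DataOver`, packaged in `exists_carrier_inputs`); the CM isogeny `φ` of `W_{Kcm}` with
`φ_sq : φ ∘ φ = [−7]` (THEOREM `CMIsogeny.exists_cmIsogeny_sq_eq_neg_seven`, p795939); the `ℚ`-side pin `I` with `hγ`.

| field (KatoShapes / PinnedFrame) | served as | term / theorem |
|---|---|---|
| `R`, `instCommRing`, `instAlgebra` | TERM | `QuadOrder (IwasawaAlgebra 7) (-7)` = `AdjoinRoot (X² + 7)` (Mathlib instances) |
| `π` | TERM | `QuadOrder.ϖ` |
| `v` | TERM | `(-1 : Rˣ)` |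
| `seven_eq` | THEOREM | `CarrierAlgebra.seven_eq` |
| `A`, `instAddCommGroup`, `instModuleΛ` | TERM | `IK.ratH` = `LocalizedModule (Submonoid.powers 7) IK.H` (Mathlib instances) |
| `instModule` | TERM | `IK.cmModuleRat hγK φ φ_sq` (the `Λ[ϖ]`-structure through `ϖ ↦ (φ_*)[1/7]`; a term, used under `letI`) |
| `instTower` | THEOREM | `CarrierAlgebra.isScalarTower` |
| `torsionFree_π` | THEOREM | `CarrierAlgebra.torsionFree_π` (unconditional: no `7`-torsion (D) + `φ_*` injective) |
| `frame.HS` | TERM | `LinearMap.range (IK.toRat hγK φ φ_sq)` |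
| `ιS` | TERM | `LocalizedModule.mkLinearMap (Submonoid.powers 7) IK.H` |
| `ιS_injective` | THEOREM | `CarrierAlgebra.ιS_injective` |
| `mem_HS_iff` | THEOREM | `CarrierAlgebra.mem_HS_iff` |
| `proj_pi` | THEOREM | `CarrierAlgebra.proj_pi` (via `endLayerMap_apply_eq_isogenyLayerMapK`: the frame's `endLayerMap` IS (L)'s `isogenyLayerMapK`) |
| `j` | TERM | `ιS ∘ₗ I.resOver IK hγ hγK` |
| `j_mem`, `j_eq` | THEOREM | `CarrierAlgebra.j_mem`, `CarrierAlgebra.j_eq` |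

BINDER column: none (no `Prop` hypothesis; named-fact debt 0).  GAP column: none.

## What the carrier IS (Kato 15.14 read on the tree's pins; (A) module docstring)

For `W ∈ 𝒞₇` (CM by an order of `K = ℚ(√−7)`, `7 = 𝔭²` ramified) Kato's `𝐇′(S′_W) = H¹_Iw(Kℚ_∞/K, T₇W)` (15.14 =
Shapiro for `G′_∞ ⊂ G_∞`) is the tree's PINNED `IK.H`; the coefficient ring `Λ_O = Λ ⊗_{ℤ₇} O_𝔭 = Λ[ϖ]/(ϖ² + 7)` acts with
`ϖ ↦ (√−7)_* = IK.isogenyMap φ IK hγK` ((L): `φ_* ∘ φ_* = −7`), and `𝐇′(𝒱′) = 𝐇′(S′_W) ⊗ ℚ` (Thm. 12.4 (2) «`𝐇¹(T) ⊗ ℚ =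
𝐇¹(V)`») is the localisation `IK.H[1/7]`, which receives `IK.H` injectively ((D): no `7`-torsion) and has no `ϖ`-torsion
((D): `φ_*` injective as `φ_*² = −7 ∣ 7`); `j = ιS ∘ res` is the Shapiro restriction `𝐇¹_Γ(T₇W) → 𝐇¹_{K,Γ}(T₇W_K)`
followed by `x ↦ x/1`.  All of this is (A)/(L)/(D); this file is the frame-letter re-export plus the `endLayerMap` bridge
and the small `A`-arithmetic the ★-column (C2) consumes (`pow_smul_mk_pow_eq_ιS`: `7^k • (x/7^k) = ιS x`).

## References

[cite: Kato2004Asterisque, 15.14 (p. 264), Thm. 12.4 (2) (p. 222), §12.2 (p. 220)] — K. Kato, *p-adic Hodge theory and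
values of zeta functions of modular forms*, Astérisque 295 (2004); [cite: SilvermanAEC2009, III.7.4] (`T_ℓ φ`);
[cite: AtiyahMacdonald1969, Ch. 3 pp. 38–39] (modules of fractions); [cite: NeukirchSchmidtWingberg2008, I §5–§6] (res,
Shapiro); [cite: SerreGaloisCohomology1997, I §2.2] (functoriality of `H¹`).  Tree: (A) p777087, (L) p776319, (D) p776780,
frames p774033 / p776025, (λ3) p795939, number-field column p782382.
-/

noncomputable section

open scoped NumberField
open Field
open Literature.NumberTheory.GaloisRepresentations
open Literature.NumberTheory.EllipticCurves
open Literature.NumberTheory.EllipticCurves.Kato2004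

namespace Summit.BirchSwinnertonDyer.Rank1Residual.Additive.GenusSeven.CarrierAlgebra

/-! ## §1 The ring column: `R = Λ_O = Λ[ϖ]/(ϖ² + 7)`, `π = ϖ`, `v = −1`, `7 = v·π²` -/

/-- **Field `seven_eq`** of `KatoGenusFrame` at `R := QuadOrder (IwasawaAlgebra 7) (-7)`, `π := ϖ`, `v := -1`:
`7 = (−1)·ϖ²` in `Λ[ϖ]/(ϖ² + 7)` — (A) `QuadOrder.natCast_eq_neg_one_mul_ϖ_sq` with the field's numeral `7` (`OfNat`) in
place of (A)'s `Nat.cast 7`. [cite: Kato2004Asterisque, 15.14 (p. 264, "O_λ[[G′_∞]]")] -/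
theorem seven_eq :
    (7 : QuadOrder (IwasawaAlgebra 7) (-7)) =
      (((-1 : (QuadOrder (IwasawaAlgebra 7) (-7))ˣ) : (QuadOrder (IwasawaAlgebra 7) (-7))ˣ) :
          QuadOrder (IwasawaAlgebra 7) (-7)) * QuadOrder.ϖ ^ 2 := by
  have h := QuadOrder.natCast_eq_neg_one_mul_ϖ_sq (Λ := IwasawaAlgebra 7) (m := -7) 7 rfl
  rwa [Nat.cast_ofNat] at h

/-- `π² = −7` in `R` (the uniformiser of `O_𝔭 = ℤ₇[√−7]`). [cite: Kato2004Asterisque, 15.14 (p. 264)] -/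
theorem π_sq : (QuadOrder.ϖ : QuadOrder (IwasawaAlgebra 7) (-7)) ^ 2 = -7 := by
  rw [QuadOrder.ϖ_sq, Int.cast_neg, Int.cast_ofNat]

/-- `π² = −7` read as `(7 : R) = −π²` (the form `torsionFree` arguments divide by).
[cite: Kato2004Asterisque, 15.14 (p. 264)] -/
theorem seven_eq_neg_π_sq : (7 : QuadOrder (IwasawaAlgebra 7) (-7)) = -QuadOrder.ϖ ^ 2 := by
  rw [π_sq, neg_neg]

/-! ## §0′ The bridge `endLayerMap = isogenyLayerMapK` (the frame's `(T₇φ)_*` IS (L)'s push-forward) -/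

/-- **The frame's layer map `endLayerMap V φ U` (PinnedFrame §0, tree `mapH1AddHom`) IS (L)'s push-forward
`isogenyLayerMapK 7 φ U` (Mathlib `ContinuousCohomology.map`)** — (L) `isogenyLayerMapK_eq_mapH1AddHom` and proof
irrelevance of the continuity witness of `T₇φ`.  This is the identification «`π` on `ιS(IK.H)` acts as `(T₇φ)_*`» the
frame's `proj_pi` is typed with. [cite: SerreGaloisCohomology1997, I §2.2] [cite: Kato2004Asterisque, 15.14 (p. 264)] -/
theorem endLayerMap_apply_eq_isogenyLayerMapK {L : Type} [Field L] (V : WeierstrassCurve L)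
    [ContinuousSMul ℤ_[7] (V.tateModule 7)] (φ : WeierstrassCurve.Isogeny V V)
    (U : Subgroup (absoluteGaloisGroup L)) (c : H1 (CM.tateRepK V 7) U) :
    endLayerMap V φ U c = isogenyLayerMapK 7 φ U c := by
  rw [isogenyLayerMapK_eq_mapH1AddHom]
  rfl

/-! ## §2 The module column over the `K`-side pin `IK` and the CM isogeny `φ` -/

section Module

variable {Kcm : Type} [Field Kcm] [NumberField Kcm] (h2 : Module.finrank ℚ Kcm = 2)
  (W : WeierstrassCurve ℚ) [ContinuousSMul ℤ_[7] ((W.baseChange Kcm).tateModule 7)]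
  (K : ZpExtension ℚ 7) {γK : absoluteGaloisGroup Kcm}
  (IK : IwasawaH1DataOver (W.baseChange Kcm) 7 (K.restrictOfFinrankEqTwo (by decide) Kcm h2) γK)
  (hγK : (K.restrictOfFinrankEqTwo (by decide) Kcm h2).IsTopGenerator γK)
  (φ : WeierstrassCurve.Isogeny (W.baseChange Kcm) (W.baseChange Kcm))
  (φ_sq : ∀ P, φ (φ P) = (-7 : ℤ) • P)

/-- **Field `instTower`** at `A := IK.ratH`, `instModule := IK.cmModuleRat hγK φ φ_sq`: `IsScalarTower Λ Λ_O 𝐇¹[1/7]`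
((A) `isScalarTower_cmModuleRat`). [cite: Kato2004Asterisque, 15.14 (p. 264) and Thm. 12.4 (2) (p. 222)] -/
theorem isScalarTower :
    letI := IK.cmModuleRat hγK φ φ_sq
    IsScalarTower (IwasawaAlgebra 7) (QuadOrder (IwasawaAlgebra 7) (-7)) IK.ratH :=
  IK.isScalarTower_cmModuleRat hγK φ φ_sq

/-- `ιS` IS (A)'s `Λ_O`-linear structure map `toRat` on elements (`rfl`). [cite: Kato2004Asterisque, Thm. 12.4 (2) (p. 222)] -/
theorem toRat_apply_eq_ιS (x : IK.H) :
    IK.toRat hγK φ φ_sq x = LocalizedModule.mkLinearMap (Submonoid.powers (7 : IwasawaAlgebra 7)) IK.H x :=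
  rfl

/-- **Field `mem_HS_iff`** at `frame.HS := LinearMap.range (IK.toRat hγK φ φ_sq)`: the `Λ_O`-submodule `𝐇′(S′_W) ≤ 𝐇′(𝒱′)`
is exactly the image of `ιS` ((A) `mem_range_toRat_iff`). [cite: Kato2004Asterisque, 15.14 (p. 264) and Thm. 12.4 (2) (p. 222)] -/
theorem mem_HS_iff :
    letI := IK.cmModule hγK φ φ_sq
    letI := IK.cmModuleRat hγK φ φ_sq
    ∀ x : IK.ratH, x ∈ LinearMap.range (IK.toRat hγK φ φ_sq) ↔
      ∃ y : IK.H, LocalizedModule.mkLinearMap (Submonoid.powers (7 : IwasawaAlgebra 7)) IK.H y = x :=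
  fun x ↦ IK.mem_range_toRat_iff hγK φ φ_sq x

/-- `ιS y ∈ HS`. [cite: Kato2004Asterisque, 15.14 (p. 264)] -/
theorem ιS_mem (y : IK.H) :
    letI := IK.cmModule hγK φ φ_sq
    letI := IK.cmModuleRat hγK φ φ_sq
    LocalizedModule.mkLinearMap (Submonoid.powers (7 : IwasawaAlgebra 7)) IK.H y ∈
      LinearMap.range (IK.toRat hγK φ φ_sq) :=
  (mem_HS_iff h2 W K IK hγK φ φ_sq _).mpr ⟨y, rfl⟩

/-- **`ιS (φ_* y) = π • ιS y`**: the CM operator of (L) on `IK.H` is `π` read through `ιS` ((A) `toRat` is `Λ_O`-linear and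
`ϖ • y = φ_* y`). [cite: Kato2004Asterisque, 15.14 (p. 264)] -/
theorem ιS_isogenyMap (y : IK.H) :
    LocalizedModule.mkLinearMap (Submonoid.powers (7 : IwasawaAlgebra 7)) IK.H (IK.isogenyMap φ IK hγK y) =
      (letI := IK.cmModuleRat hγK φ φ_sq;
        (QuadOrder.ϖ : QuadOrder (IwasawaAlgebra 7) (-7)) •
          LocalizedModule.mkLinearMap (Submonoid.powers (7 : IwasawaAlgebra 7)) IK.H y) := by
  letI := IK.cmModule hγK φ φ_sq
  letI := IK.cmModuleRat hγK φ φ_sq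
  rw [← IK.ϖ_smul_eq_isogenyMap hγK φ φ_sq y, ← toRat_apply_eq_ιS h2 W K IK hγK φ φ_sq,
    ← toRat_apply_eq_ιS h2 W K IK hγK φ φ_sq, map_smul]

/-- The converse direction used by consumers: `y′ := φ_* y` HAS `ιS y′ = π • ιS y`, so the frame's `piK` is (L)'s
`isogenyMap φ` (cf. `PinnedKatoGenusFrame.eq_piK_of_ιS_eq`). [cite: Kato2004Asterisque, 15.14 (p. 264)] -/
theorem exists_ιS_eq_π_smul (y : IK.H) :
    ∃ y' : IK.H, LocalizedModule.mkLinearMap (Submonoid.powers (7 : IwasawaAlgebra 7)) IK.H y' =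
      (letI := IK.cmModuleRat hγK φ φ_sq;
        (QuadOrder.ϖ : QuadOrder (IwasawaAlgebra 7) (-7)) •
          LocalizedModule.mkLinearMap (Submonoid.powers (7 : IwasawaAlgebra 7)) IK.H y) :=
  ⟨IK.isogenyMap φ IK hγK y, ιS_isogenyMap h2 W K IK hγK φ φ_sq y⟩

/-! ### `Λ` acts on `A` through `Λ_O`; `7` acts invertibly on `A = 𝐇¹[1/7]` (the (C2) engine) -/

/-- `f • x = (algebraMap Λ Λ_O f) • x` on `A` (the tower). [cite: Kato2004Asterisque, 15.14 (p. 264, "⊗_{O_λ[[G′_∞]]} O_λ[[G_∞]]")] -/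
theorem iwasawa_smul_eq (f : IwasawaAlgebra 7) (x : IK.ratH) :
    f • x = (letI := IK.cmModuleRat hγK φ φ_sq; algebraMap (IwasawaAlgebra 7) (QuadOrder (IwasawaAlgebra 7) (-7)) f • x) := by
  letI := IK.cmModuleRat hγK φ φ_sq
  haveI := IK.isScalarTower_cmModuleRat hγK φ φ_sq
  exact (algebraMap_smul (QuadOrder (IwasawaAlgebra 7) (-7)) f x).symm

/-- **`7^k • (x / 7^k) = ιS x` in `𝐇¹[1/7]`** — the class `7^{−k}·ιS x` exists in `A` and `7^k` times it is `ιS x`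
(Mathlib `LocalizedModule.smul'_mk`, `mk_cancel`).  The ★-column (C2) places `zS := 7^{−k}·j(zOne)` with this.
[cite: AtiyahMacdonald1969, Ch. 3, pp. 38–39 (S⁻¹M)] [cite: Kato2004Asterisque, §13.9 (p. 230, "z_γ^{(p)} ∈ 𝐇¹ ⊗ ℚ")] -/
theorem pow_smul_mk_pow_eq_ιS (k : ℕ) (x : IK.H) :
    ((7 : IwasawaAlgebra 7) ^ k) •
        (LocalizedModule.mk x (⟨(7 : IwasawaAlgebra 7) ^ k, k, rfl⟩ : Submonoid.powers (7 : IwasawaAlgebra 7)) : IK.ratH) =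
      LocalizedModule.mkLinearMap (Submonoid.powers (7 : IwasawaAlgebra 7)) IK.H x := by
  rw [LocalizedModule.mkLinearMap_apply, LocalizedModule.smul'_mk]
  exact LocalizedModule.mk_cancel (⟨(7 : IwasawaAlgebra 7) ^ k, k, rfl⟩ : Submonoid.powers (7 : IwasawaAlgebra 7)) x

/-- `x / 1 = ιS x` (unfolding `mkLinearMap`). [cite: AtiyahMacdonald1969, Ch. 3, pp. 38–39] -/
theorem mk_one_eq_ιS (x : IK.H) :
    (LocalizedModule.mk x (1 : Submonoid.powers (7 : IwasawaAlgebra 7)) : IK.ratH) =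
      LocalizedModule.mkLinearMap (Submonoid.powers (7 : IwasawaAlgebra 7)) IK.H x :=
  rfl

/-! ### The three fields that use `W` elliptic (no `7`-torsion, `φ_*` injective: file (D)) -/

section Elliptic

variable [W.IsElliptic]

/-- **Field `torsionFree_π`** at the concrete carrier, UNCONDITIONAL: `𝐇¹_{K,Γ}(T₇W_K)[1/7]` has no `ϖ`-torsion for the
`Λ_O`-structure through `φ_*` — (A) `eq_zero_of_ϖ_smul_eq_zero_rat` with `−7 ∣ 7¹`, over (D) (no `7`-torsion, `φ_*`
injective). [cite: Kato2004Asterisque, Thm. 12.4 (2) (p. 222, "torsion free") and 15.14 (p. 264)] -/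
theorem torsionFree_π :
    letI := IK.cmModuleRat hγK φ φ_sq
    ∀ x : IK.ratH, (QuadOrder.ϖ : QuadOrder (IwasawaAlgebra 7) (-7)) • x = 0 → x = 0 := by
  haveI : (W.baseChange Kcm).IsElliptic := inferInstanceAs ((W.map (algebraMap ℚ Kcm)).IsElliptic)
  intro x hx
  exact IK.eq_zero_of_ϖ_smul_eq_zero_rat hγK φ φ_sq (k := 1) (by norm_num) x hx

/-- **Field `ιS_injective`** at `ιS := LocalizedModule.mkLinearMap (Submonoid.powers 7) IK.H`: `𝐇¹ → 𝐇¹[1/7]` is injective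
((A) `mkLinearMap_powers_injective`, from (D): no `7`-torsion). [cite: Kato2004Asterisque, Thm. 12.4 (2) (p. 222)] -/
theorem ιS_injective :
    Function.Injective
      (LocalizedModule.mkLinearMap (Submonoid.powers (7 : IwasawaAlgebra 7)) IK.H :
        IK.H →ₗ[IwasawaAlgebra 7] IK.ratH) := by
  haveI : (W.baseChange Kcm).IsElliptic := inferInstanceAs ((W.map (algebraMap ℚ Kcm)).IsElliptic)
  exact IK.mkLinearMap_powers_injective

/-- **Field `proj_pi`** at the concrete carrier: if `ιS y′ = π • ιS y` in `𝐇¹[1/7]` then every layer class of `y′` is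
`(T₇φ)_*` of that of `y` — (A) `proj_eq_of_toRat_eq_ϖ_smul` (no `7`-torsion ⇒ `y′ = φ_* y`; (L) `proj_isogenyMap`) with the
frame's `endLayerMap` in place of (L)'s `isogenyLayerMapK` (`endLayerMap_apply_eq_isogenyLayerMapK`).
[cite: Kato2004Asterisque, 15.14 (p. 264, "O_λ acts on H^q(T)")] [cite: SerreGaloisCohomology1997, I §2.2] -/
theorem proj_pi (n : ℕ) (y y' : IK.H)
    (h : LocalizedModule.mkLinearMap (Submonoid.powers (7 : IwasawaAlgebra 7)) IK.H y' =
      (letI := IK.cmModuleRat hγK φ φ_sq;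
        (QuadOrder.ϖ : QuadOrder (IwasawaAlgebra 7) (-7)) •
          LocalizedModule.mkLinearMap (Submonoid.powers (7 : IwasawaAlgebra 7)) IK.H y)) :
    IK.proj n y' =
      endLayerMap (W.baseChange Kcm) φ ((K.restrictOfFinrankEqTwo (by decide) Kcm h2).layerSubgroup n)
        (IK.proj n y) := by
  haveI : (W.baseChange Kcm).IsElliptic := inferInstanceAs ((W.map (algebraMap ℚ Kcm)).IsElliptic)
  rw [endLayerMap_apply_eq_isogenyLayerMapK]
  exact IK.proj_eq_of_toRat_eq_ϖ_smul hγK φ φ_sq n y y' h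

end Elliptic

end Module

/-! ## §3 The coefficient extension `j = ιS ∘ res` over the `ℚ`-side pin `I` -/

section Shapiro

variable {Kcm : Type} [Field Kcm] [NumberField Kcm] (h2 : Module.finrank ℚ Kcm = 2)
  (W : WeierstrassCurve ℚ) [W.IsElliptic] [ContinuousSMul ℤ_[7] (W.tateModule 7)]
  [ContinuousSMul ℤ_[7] ((W.baseChange Kcm).tateModule 7)]
  (K : ZpExtension ℚ 7) {γ : absoluteGaloisGroup ℚ} (I : IwasawaH1Data W 7 K γ) (hγ : K.IsTopGenerator γ)
  {γK : absoluteGaloisGroup Kcm}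
  (IK : IwasawaH1DataOver (W.baseChange Kcm) 7 (K.restrictOfFinrankEqTwo (by decide) Kcm h2) γK)
  (hγK : (K.restrictOfFinrankEqTwo (by decide) Kcm h2).IsTopGenerator γK)
  (φ : WeierstrassCurve.Isogeny (W.baseChange Kcm) (W.baseChange Kcm))
  (φ_sq : ∀ P, φ (φ P) = (-7 : ℤ) • P)

/-- **Field `j_mem`** at `j := ιS ∘ₗ I.resOver IK hγ hγK`, `frame.HS := range (IK.toRat …)`: `j z ∈ 𝐇′(S′_W)`.
[cite: Kato2004Asterisque, 15.14 (p. 264)] [cite: NeukirchSchmidtWingberg2008, I §6 (Shapiro)] -/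
theorem j_mem :
    letI := IK.cmModule hγK φ φ_sq
    letI := IK.cmModuleRat hγK φ φ_sq
    ∀ z : I.H, (LocalizedModule.mkLinearMap (Submonoid.powers (7 : IwasawaAlgebra 7)) IK.H ∘ₗ
        I.resOver IK hγ hγK) z ∈ LinearMap.range (IK.toRat hγK φ φ_sq) :=
  fun _ ↦ ιS_mem h2 W K IK hγK φ φ_sq _

/-- **Field `j_eq`** (the factorisation `j = ιS ∘ res` for EVERY witness `hγ′` of `K.IsTopGenerator γ`): definitional
(proof irrelevance in `hγ`). [cite: NeukirchSchmidtWingberg2008, I §5–§6] -/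
theorem j_eq :
    ∀ hγ' : K.IsTopGenerator γ,
      (LocalizedModule.mkLinearMap (Submonoid.powers (7 : IwasawaAlgebra 7)) IK.H ∘ₗ I.resOver IK hγ hγK :
          I.H →ₗ[IwasawaAlgebra 7] IK.ratH) =
        LocalizedModule.mkLinearMap (Submonoid.powers (7 : IwasawaAlgebra 7)) IK.H ∘ₗ I.resOver IK hγ' hγK :=
  fun _ ↦ rfl

/-- `j z = ιS (res z)` pointwise (unfolding the composition). [cite: NeukirchSchmidtWingberg2008, I §5–§6] -/
theorem j_apply (z : I.H) :
    (LocalizedModule.mkLinearMap (Submonoid.powers (7 : IwasawaAlgebra 7)) IK.H ∘ₗ I.resOver IK hγ hγK) z =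
      LocalizedModule.mkLinearMap (Submonoid.powers (7 : IwasawaAlgebra 7)) IK.H (I.resOver IK hγ hγK z) :=
  rfl

/-- The layers of `res z`: `IK.proj n (res z) = res_n (I.proj n z)` (tree `proj_resOver`, re-exported at the frame's
tower `K.restrictOfFinrankEqTwo`). [cite: NeukirchSchmidtWingberg2008, I §5 Prop. 1.5.4] -/
theorem proj_resOver (n : ℕ) (z : I.H) :
    IK.proj n (I.resOver IK hγ hγK z) = layerResOver K _ W n (I.proj n z) :=
  I.proj_resOver IK hγ hγK n z

/-- **`j (7^k • z) = 7^k • j z` and the (C2) placement**: for `z : I.H` the class `j z / 7^k ∈ A` satisfies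
`7^k • (j z / 7^k) = j z`. [cite: Kato2004Asterisque, §13.9 (p. 230)] [cite: AtiyahMacdonald1969, Ch. 3, pp. 38–39] -/
theorem pow_smul_mk_resOver_pow (k : ℕ) (z : I.H) :
    ((7 : IwasawaAlgebra 7) ^ k) •
        (LocalizedModule.mk (I.resOver IK hγ hγK z)
          (⟨(7 : IwasawaAlgebra 7) ^ k, k, rfl⟩ : Submonoid.powers (7 : IwasawaAlgebra 7)) : IK.ratH) =
      (LocalizedModule.mkLinearMap (Submonoid.powers (7 : IwasawaAlgebra 7)) IK.H ∘ₗ I.resOver IK hγ hγK) z :=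
  pow_smul_mk_pow_eq_ιS h2 W K IK k _

end Shapiro

/-! ## §4 Sourcing the first binders: `γK`, `hγK`, `IK` exist for every quadratic `Kcm` (and `φ` by p795939) -/

/-- **The data binders of the carrier column are themselves inhabited**: for every quadratic number field `Kcm` and
every cyclotomic datum `K : ZpExtension ℚ 7` there are a topological generator `γK` of `Kℚ_∞/Kcm`
(`NumberFieldColumn`'s `exists_isTopGenerator_γK`) and a `K`-side pinned Iwasawa cohomology `IK` of `T₇W_{Kcm}` along it
(`nonempty_iwasawaH1DataOver`); the CM isogeny `φ` with `φ_sq` is `CMIsogeny.exists_cmIsogeny_sq_eq_neg_seven` (p795939,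
not re-derived here). [cite: Kato2004Asterisque, §12.2 (12.2.1) (p. 220) and 15.14 (p. 264)] [cite: Washington1997, §13.2] -/
theorem exists_carrier_inputs {Kcm : Type} [Field Kcm] [NumberField Kcm] (h2 : Module.finrank ℚ Kcm = 2)
    (W : WeierstrassCurve ℚ) [ContinuousSMul ℤ_[7] ((W.baseChange Kcm).tateModule 7)] (K : ZpExtension ℚ 7) :
    ∃ (γK : absoluteGaloisGroup Kcm) (_ : (K.restrictOfFinrankEqTwo (by decide) Kcm h2).IsTopGenerator γK),
      Nonempty (IwasawaH1DataOver (W.baseChange Kcm) 7 (K.restrictOfFinrankEqTwo (by decide) Kcm h2) γK) := by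
  obtain ⟨γK, hγK⟩ := exists_isTopGenerator_γK K Kcm h2
  exact ⟨γK, hγK, nonempty_iwasawaH1DataOver (W.baseChange Kcm) 7 _ hγK⟩

end Summit.BirchSwinnertonDyer.Rank1Residual.Additive.GenusSeven.CarrierAlgebra

end
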